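import Mathlib.GroupTheory.ResiduallyFinite
import Mathlib.GroupTheory.FreeGroup.Reduce
import Mathlib.GroupTheory.Perm.Basic
import Mathlib.Logic.Equiv.Fintype
import HarnessLib

/-!
# Free groups are residually finite

Topic `Literature/GroupTheory/CombinatorialGroupTheory`.  Mathlib (at the pinned revision) has the class
`Group.ResiduallyFinite` (`Mathlib/GroupTheory/ResiduallyFinite.lean`) but no instance for free groups; this
file supplies the classical theorem

* `Literature.GroupTheory.CombinatorialGroupTheory.freeGroup_residuallyFinite` :
  `Group.ResiduallyFinite (FreeGroup α)` for every type `α` of generators,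

through the classical permutation-representation proof (Lyndon–Schupp, *Combinatorial Group Theory*,
Ch. I §3; the argument goes back to Schreier and M. Hall): given a non-trivial element with reduced word
`L = l₀ l₁ ⋯ l_{n-1}`, `lᵢ ∈ {a, a⁻¹}`, one builds an action of `FreeGroup α` on the `n+1` points
`0, 1, …, n` in which the letter `lᵢ` carries the point `i+1` to the point `i` (`exists_perm_chain`);
reducedness of `L` is exactly what makes the prescribed partial maps injective (`src_injective`,
`tgt_injective`), and any partial injection of a finite set extends to a permutation
(`Equiv.extendSubtype`).  The word then carries `n` to `0` (`lift_mk_apply_last`), so it acts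
non-trivially in the finite group `Equiv.Perm (Fin (n+1))` (`exists_perm_apply_ne`).

Also recorded: the quotient form used by consumers — every non-trivial element of a free group lies
outside some normal subgroup of finite index (`exists_finiteIndex_normal_notMem`).
-/

namespace Literature.GroupTheory.CombinatorialGroupTheory

open Equiv

variable {α : Type*}

/-! ## Acting along a word: the chain lemma -/

/-- **Chain lemma.** Let `L` be a word in the letters `α × Bool` and `pts : Fin (L.length + 1) → X` points
of a type `X` on which permutations `σ a` (`a : α`) act so that the `k`-th letter carries `pts (k+1)` to
`pts k` (`σ a (pts (k+1)) = pts k` if the letter is `(a, true) = a`, and `σ a (pts k) = pts (k+1)` if it is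
`(a, false) = a⁻¹`).  Then the element `FreeGroup.mk L`, acting through `FreeGroup.lift σ`, carries the
last point to the first. [folklore] -/
theorem lift_mk_apply_last {X : Type*} (σ : α → Perm X) :
    ∀ (L : List (α × Bool)) (pts : Fin (L.length + 1) → X),
      (∀ k : Fin L.length, ((L.get k).2 = true → σ (L.get k).1 (pts k.succ) = pts k.castSucc) ∧
        ((L.get k).2 = false → σ (L.get k).1 (pts k.castSucc) = pts k.succ)) →
      FreeGroup.lift σ (FreeGroup.mk L) (pts (Fin.last L.length)) = pts 0
  | [], _, _ => by simp
  | (a, b) :: L, pts, h => by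
    have hcons : FreeGroup.mk ((a, b) :: L) = FreeGroup.mk [(a, b)] * FreeGroup.mk L := by
      rw [FreeGroup.mul_mk]; rfl
    -- the tail acts on the shifted points
    have ih := lift_mk_apply_last σ L (fun j => pts j.succ) (fun k => by
      have hk := h k.succ
      simpa using hk)
    have hlast : (Fin.last L.length).succ = Fin.last ((a, b) :: L).length := by
      ext; simp
    rw [hcons, MonoidHom.map_mul, Perm.mul_apply, ← hlast]
    change FreeGroup.lift σ (FreeGroup.mk [(a, b)]) (FreeGroup.lift σ (FreeGroup.mk L)
      ((fun j : Fin (L.length + 1) => pts j.succ) (Fin.last L.length))) = pts 0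
    rw [ih]
    have h0 := h ⟨0, by simp⟩
    cases b
    · -- letter `a⁻¹`: `σ a (pts 0) = pts 1`
      have e : σ a (pts 0) = pts (Fin.succ 0) := by
        have := h0.2 rfl
        simpa using this
      simp only [FreeGroup.lift_mk, List.map_cons, List.map_nil, List.prod_cons, List.prod_nil, mul_one,
        cond_false]
      rw [Perm.inv_eq_iff_eq]
      exact e.symm
    · -- letter `a`: `σ a (pts 1) = pts 0`
      have e : σ a (pts (Fin.succ 0)) = pts 0 := by
        have := h0.1 rfl
        simpa using this
      simp only [FreeGroup.lift_mk, List.map_cons, List.map_nil, List.prod_cons, List.prod_nil, mul_one,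
        cond_true]
      exact e

/-! ## Building the permutations from a reduced word -/

section Construction

variable (L : List (α × Bool))

/-- Adjacent letters of a reduced word with the same generator have the same sign (no `a a⁻¹`, no `a⁻¹ a`).
[folklore] -/
theorem isReduced_getElem (hL : FreeGroup.IsReduced L) (i : ℕ) (hi : i + 1 < L.length)
    (h1 : (L[i]).1 = (L[i + 1]).1) : (L[i]).2 = (L[i + 1]).2 := by
  have hc : List.IsChain (fun x y : α × Bool => x.1 = y.1 → x.2 = y.2) L := hL
  exact hc.getElem i hi h1

/-- In a REDUCED word, two distinct letters with the same generator have distinct SOURCE endpoints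
(`k ↦ k+1` for a positive letter, `k ↦ k` for a negative one): a collision is an adjacent pair `a a⁻¹`.
[folklore] -/
theorem src_injective (hL : FreeGroup.IsReduced L) (a : α) :
    Function.Injective (fun k : {k : Fin L.length // (L.get k).1 = a} =>
      (if (L.get k.1).2 then k.1.succ else k.1.castSucc : Fin (L.length + 1))) := by
  rintro ⟨⟨i, hi⟩, hk⟩ ⟨⟨j, hj⟩, hk'⟩ h
  simp only [Subtype.mk.injEq, Fin.mk.injEq]
  have hv := congrArg Fin.val h
  simp only [List.get_eq_getElem] at hk hk' hv
  cases hbi : (L[i]).2 <;> cases hbj : (L[j]).2 <;>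
    simp only [hbi, hbj, Bool.false_eq_true, ↓reduceIte, Fin.val_castSucc, Fin.val_succ] at hv
  · exact hv
  · -- `i = j + 1`: letters `j` = `(a, true)`, `j + 1 = i` = `(a, false)` are adjacent — not reduced
    exfalso
    obtain rfl : i = j + 1 := by omega
    have := isReduced_getElem L hL j hi (by rw [hk', hk])
    rw [hbi, hbj] at this
    exact Bool.noConfusion this
  · -- `i + 1 = j`: letters `i` = `(a, true)`, `i + 1 = j` = `(a, false)` adjacent — not reduced
    exfalso
    obtain rfl : j = i + 1 := by omega
    have := isReduced_getElem L hL i hj (by rw [hk, hk'])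
    rw [hbi, hbj] at this
    exact Bool.noConfusion this
  · omega

/-- Dually, the TARGET endpoints (`k` for a positive letter, `k+1` for a negative one) of the `a`-letters of
a reduced word are distinct: a collision is an adjacent pair `a⁻¹ a`. [folklore] -/
theorem tgt_injective (hL : FreeGroup.IsReduced L) (a : α) :
    Function.Injective (fun k : {k : Fin L.length // (L.get k).1 = a} =>
      (if (L.get k.1).2 then k.1.castSucc else k.1.succ : Fin (L.length + 1))) := by
  rintro ⟨⟨i, hi⟩, hk⟩ ⟨⟨j, hj⟩, hk'⟩ h
  simp only [Subtype.mk.injEq, Fin.mk.injEq]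
  have hv := congrArg Fin.val h
  simp only [List.get_eq_getElem] at hk hk' hv
  cases hbi : (L[i]).2 <;> cases hbj : (L[j]).2 <;>
    simp only [hbi, hbj, Bool.false_eq_true, ↓reduceIte, Fin.val_castSucc, Fin.val_succ] at hv
  · omega
  · -- `i + 1 = j`: letters `i` = `(a, false)`, `i + 1 = j` = `(a, true)` adjacent — not reduced
    exfalso
    obtain rfl : j = i + 1 := by omega
    have := isReduced_getElem L hL i hj (by rw [hk, hk'])
    rw [hbi, hbj] at this
    exact Bool.noConfusion this
  · -- `i = j + 1`: letters `j` = `(a, false)`, `j + 1 = i` = `(a, true)` adjacent — not reduced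
    exfalso
    obtain rfl : i = j + 1 := by omega
    have := isReduced_getElem L hL j hi (by rw [hk', hk])
    rw [hbi, hbj] at this
    exact Bool.noConfusion this
  · exact hv

/-- **Permutations realising a reduced word.** For a reduced word `L` there are permutations `σ a` of the
`L.length + 1` points such that every letter carries the point after it to the point before it
(positive letter `a` at position `k`: `σ a (k+1) = k`; negative letter: `σ a k = k+1`).  Each `σ a` is an
extension (`Equiv.extendSubtype`) of the partial injection "source endpoint ↦ target endpoint" of the
`a`-letters, well defined and injective by `src_injective` / `tgt_injective`. [folklore] -/
theorem exists_perm_chain (hL : FreeGroup.IsReduced L) :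
    ∃ σ : α → Perm (Fin (L.length + 1)), ∀ k : Fin L.length,
      ((L.get k).2 = true → σ (L.get k).1 k.succ = k.castSucc) ∧
        ((L.get k).2 = false → σ (L.get k).1 k.castSucc = k.succ) := by
  classical
  -- for each generator `a`: the `a`-letters, their source and target endpoints
  let E : α → Type := fun a => {k : Fin L.length // (L.get k).1 = a}
  let src : ∀ a, E a → Fin (L.length + 1) := fun a k => if (L.get k.1).2 then k.1.succ else k.1.castSucc
  let tgt : ∀ a, E a → Fin (L.length + 1) := fun a k => if (L.get k.1).2 then k.1.castSucc else k.1.succ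
  have hsrc : ∀ a, Function.Injective (src a) := fun a => src_injective L hL a
  have htgt : ∀ a, Function.Injective (tgt a) := fun a => tgt_injective L hL a
  -- the partial injection `src k ↦ tgt k`, as an equivalence between the two ranges
  let e : ∀ a, {i // i ∈ Set.range (src a)} ≃ {j // j ∈ Set.range (tgt a)} := fun a =>
    (Equiv.ofInjective (src a) (hsrc a)).symm.trans (Equiv.ofInjective (tgt a) (htgt a))
  refine ⟨fun a => (e a).extendSubtype, fun k => ?_⟩
  -- the `k`-th letter is an edge for its own generator
  have hmem : src (L.get k).1 ⟨k, rfl⟩ ∈ Set.range (src (L.get k).1) := ⟨⟨k, rfl⟩, rfl⟩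
  have key : (e (L.get k).1).extendSubtype (src (L.get k).1 ⟨k, rfl⟩) = tgt (L.get k).1 ⟨k, rfl⟩ := by
    rw [Equiv.extendSubtype_apply_of_mem _ _ hmem]
    simp only [e, Equiv.trans_apply]
    have h1 : (Equiv.ofInjective (src (L.get k).1) (hsrc (L.get k).1)).symm ⟨src (L.get k).1 ⟨k, rfl⟩, hmem⟩ =
        ⟨k, rfl⟩ :=
      Equiv.ofInjective_symm_apply (hsrc (L.get k).1) ⟨k, rfl⟩
    rw [h1]
    rfl
  have hs : src (L.get k).1 ⟨k, rfl⟩ = if (L.get k).2 then k.succ else k.castSucc := rfl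
  have ht : tgt (L.get k).1 ⟨k, rfl⟩ = if (L.get k).2 then k.castSucc else k.succ := rfl
  rw [hs, ht] at key
  constructor
  · intro hb
    rw [hb] at key
    simpa using key
  · intro hb
    rw [hb] at key
    simpa using key

end Construction

/-! ## Residual finiteness -/

/-- **Every non-trivial element of a free group acts non-trivially on some finite set**: if `x ≠ 1` has
reduced word of length `n`, there is a homomorphism `FreeGroup α →* Equiv.Perm (Fin (n+1))` under which `x`
moves the point `n` (to the point `0`). [folklore] -/
theorem exists_perm_apply_ne [DecidableEq α] (x : FreeGroup α) (hx : x ≠ 1) :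
    ∃ (n : ℕ) (f : FreeGroup α →* Perm (Fin (n + 1))), f x ≠ 1 := by
  have hL : FreeGroup.IsReduced x.toWord := FreeGroup.isReduced_toWord
  have hne : x.toWord ≠ [] := fun h => hx (FreeGroup.toWord_eq_nil_iff.1 h)
  obtain ⟨σ, hσ⟩ := exists_perm_chain x.toWord hL
  refine ⟨x.toWord.length, FreeGroup.lift σ, fun h1 => ?_⟩
  have hmove := lift_mk_apply_last σ x.toWord id hσ
  rw [FreeGroup.mk_toWord, h1] at hmove
  have hval := congrArg Fin.val hmove
  simp only [Perm.one_apply, id_eq, Fin.val_last, Fin.val_zero] at hval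
  exact hne (List.eq_nil_of_length_eq_zero hval)

/-- **Free groups are residually finite** (Schreier; Lyndon–Schupp, Combinatorial Group Theory, Ch. I §3):
for every type of generators `α`, the intersection of the finite-index normal subgroups of `FreeGroup α` is
trivial.  Proof: a non-trivial element with reduced word of length `n` acts non-trivially on `n+1` points
(`exists_perm_apply_ne`), i.e. survives in the finite group `Equiv.Perm (Fin (n+1))`.
[cite: LyndonSchupp2001, Ch. I §3 (free groups are residually finite)] -/
theorem freeGroup_residuallyFinite (α : Type*) : Group.ResiduallyFinite (FreeGroup α) := by
  classical
  refine Group.residuallyFinite_of_forall_exists_finite_monoidHom fun x hx => ?_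
  obtain ⟨n, f, hf⟩ := exists_perm_apply_ne x hx
  exact ⟨Perm (Fin (n + 1)), inferInstance, inferInstance, f, hf⟩

/-- **Quotient form.** Every non-trivial element of a free group lies outside some normal subgroup of finite
index. [cite: LyndonSchupp2001, Ch. I §3 (free groups are residually finite)] -/
theorem exists_finiteIndex_normal_notMem (x : FreeGroup α) (hx : x ≠ 1) :
    ∃ N : Subgroup (FreeGroup α), N.Normal ∧ N.FiniteIndex ∧ x ∉ N := by
  haveI := freeGroup_residuallyFinite α
  obtain ⟨N, hN⟩ := Group.exists_finiteIndexNormalSubgroup_notMem x hx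
  exact ⟨N.toSubgroup, inferInstance, inferInstance, hN⟩

end Literature.GroupTheory.CombinatorialGroupTheory
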